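import Summits.CriticalPhenomena.PercolationContinuityZ3.Theorems.PercNearOneGluingNoHeavyLowerTailIncStarPkCounterexample
import HarnessLib

/-!
# Gladkov's Conjecture 10.1 admits no linear rate with constant `≤ 5`: certified chain-hub witnesses
# (Sahi programme, prover prim-sahi-p2 gen 51)

Support file of the cell `prim-sahi` (`--supports stmt-CriticalPhenomena-4575`).  No definitions, no named facts,
no sorries; the two witnesses are evaluated by `native_decide` (DECLARED below: `conj101_ratio_gt_four`,
`conj101_ratio_gt_five` and their weight checks depend on `Lean.ofReduceBool`); everything else is standard.

CONTEXT.  Gladkov [arXiv:2408.08457, Conjecture 10.1 (p. 18) = Gladkov–Zimin 2024, Conj. 6.3; "the notorious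
Conjecture 10.1", §7.3] asks: for every `ε > 0` there is `δ > 0` such that, for Bernoulli bond percolation with
arbitrary edge probabilities and vertices `a, b, c`,
`P(ab|c) < δ ⟹ P(abc)·P(a|b|c) − P(ac|b)·P(a|bc) < ε`
(cells as in `Literature.Probability.Percolation.gladkov2024_thm_1_3`: `abc = {a↔b}∩{a↔c}`, `ab|c = {a↔b}∩{a↔c}ᶜ`,
`ac|b = {a↔c}∩{a↔b}ᶜ`, `a|bc = {b↔c}∩{a↔b}ᶜ`, `a|b|c = {a↔b}ᶜ∩{a↔c}ᶜ∩{b↔c}ᶜ`).  By Aas–Gladkov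
(`Literature.Probability.Percolation.prodBernoulli_threePoint_strongHarris`) the left side `Δ := P(abc)P(a|b|c) − P(ac|b)P(a|bc)`
is `≥ P(ab|c)·(P(ac|b)+P(a|bc)) ≥ 0`, and `Δ = 0` when `c` separates `a` from `b` (then `{c↔a}`, `{c↔b}` are independent), so the
conjecture is a stability statement.  The NATURAL QUANTITATIVE FORM would be a linear rate `Δ ≤ K·P(ab|c)` for a universal `K`
(numerically `Δ ≤ P(ab|c)` on the star `K_{1,3}` and on the triangle, where `Δ = P(ab|c)·x(1−yz)` resp. `P(ab|c)·(1−z)u₀` in the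
edge weights — memo §2).

WHAT IS PROVED HERE.  The linear form FAILS for `K = 4` and for `K = 5`: on the "chain-hub" graphs
`CH_k` = vertices `a, b, c, h₁, …, h_k`, pairs `c–h_i` (weight `x`), `a–h₁`, `h_k–b`, `h_i–h_{i+1}` (weight `t`) and `a–c`
(weight `1 − η`),
* `conj101_ratio_gt_four`: `CH_4` on `Fin 7` with `(x, t, η) = (9/10, 1/10, 1/100)` has `Δ > 4·P(ab|c)` (exactly: ratio `4.1652…`,
  `P(ab|c) = 10⁻¹¹`);
* `conj101_ratio_gt_five`: `CH_5` on `Fin 8` with `(x, t, η) = (19/20, 1/20, 1/100)` has `Δ > 5·P(ab|c)` (ratio `5.4648…`,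
  `P(ab|c) = 4.88·10⁻¹⁷`);
hence `not_conj101_rate_four` / `not_conj101_rate_five`: NO statement "`Δ ≤ K·P(ab|c)` on every finite weighted graph" holds
with `K ≤ 5`.  The memo (`run/shared/lean/prim/prim-sahi/FROM-prim-sahi-p2-gen51-*.md` §2, `prim-sahi-p2/PROOF-E3.md` §61)
derives the first-order asymptotics `Δ/P(ab|c) → k + 1` on `CH_k` as `x → 1`, then `t, η → 0` (exact symbolic check for
`k ≤ 3`, exact rationals for `k ≤ 5`), so the supremum of `Δ/P(ab|c)` over finite weighted graphs is `+∞` [conjecture-free for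
`K ≤ 5` by this file; the general claim is the memo's]: any `δ(ε)` in Conjecture 10.1 must be `o(ε)`.  Gladkov's printed rate for
the weaker Theorem 1.3 is `δ = ε³/4` (`Literature.Probability.Percolation.Gladkov.thm_1_3_rate_algebra`).  Nothing here bears on the
truth of Conjecture 10.1 itself (an `ε`–`δ` statement), on Sahi's `C₃`, or on the crux `NoHeavyLowerTail`.

Method = the exact-rational weighted machinery of `AdditiveGluing/Negative/CertWeighted.lean` (as in `…IncStarPkCounterexample`):
`prodBernoulli_real_eq_wsum` turns each cell probability of `prodBernoulli (wOfList l)` into a weighted count over the `2^m`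
sub-configurations read off the reach tables; `conj101_lt_of_wcheck` turns one rational comparison into the real inequality.
-/

namespace Summit.CriticalPhenomena.PercolationContinuityZ3.Theorems

namespace GladkovRate

open MeasureTheory
open Literature.Probability.LatticeModels Literature.Probability.Percolation
open Summit.CriticalPhenomena.PercolationContinuityZ3.Theorems.AdditiveGluing.Negative.Cert

/-! ### Cell probabilities as weighted counts -/

/-- `P(x ↔ y, u ↮ v)` is the weighted count of the reach-table test "bit `y` of row `x` and not bit `v` of row `u`".
[this work] -/
theorem real_conn_notConn_eq_wcount {n : ℕ} {l : List (Fin n × Fin n × ℚ)} (hnd : (wPairs l).Nodup)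
    (hq : ∀ e ∈ l, 0 ≤ e.2.2 ∧ e.2.2 ≤ 1) (x y u v : Fin n) :
    (prodBernoulli (wOfList l)).real (openConn x y ∩ (openConn u v)ᶜ) =
      ((((wtabs n l).map fun t =>
        if (t.1.getD x 0).testBit y && !(t.1.getD u 0).testBit v then t.2 else 0).sum : ℚ) : ℝ) := by
  classical
  rw [prodBernoulli_real_eq_wsum hnd hq]
  exact (cast_sum_wtabs_pos l (fun tb => (tb.getD x 0).testBit y && !(tb.getD u 0).testBit v)
    (fun S => (↑S : Set (Sym2 (Fin n))) ∈ openConn x y ∩ (openConn u v)ᶜ)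
    (fun ω => by
      rw [Bool.and_eq_true, Bool.not_eq_true', testBit_reachTable_iff_mem_openConn,
        ← Bool.not_eq_true, testBit_reachTable_iff_mem_openConn]
      rfl)).symm

/-- `P(a|b|c) = P(a ↮ b, a ↮ c, b ↮ c)` is the weighted count of the test "no bit `b`, `c` in row `a`, no bit `c` in row `b`".
[this work] -/
theorem real_sep3_eq_wcount {n : ℕ} {l : List (Fin n × Fin n × ℚ)} (hnd : (wPairs l).Nodup)
    (hq : ∀ e ∈ l, 0 ≤ e.2.2 ∧ e.2.2 ≤ 1) (a b c : Fin n) :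
    (prodBernoulli (wOfList l)).real ((openConn a b)ᶜ ∩ (openConn a c)ᶜ ∩ (openConn b c)ᶜ) =
      ((((wtabs n l).map fun t =>
        if !(t.1.getD a 0).testBit b && !(t.1.getD a 0).testBit c && !(t.1.getD b 0).testBit c
          then t.2 else 0).sum : ℚ) : ℝ) := by
  classical
  rw [prodBernoulli_real_eq_wsum hnd hq]
  exact (cast_sum_wtabs_pos l
    (fun tb => !(tb.getD a 0).testBit b && !(tb.getD a 0).testBit c && !(tb.getD b 0).testBit c)
    (fun S => (↑S : Set (Sym2 (Fin n))) ∈ (openConn a b)ᶜ ∩ (openConn a c)ᶜ ∩ (openConn b c)ᶜ)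
    (fun ω => by
      rw [Bool.and_eq_true, Bool.and_eq_true, Bool.not_eq_true', Bool.not_eq_true', Bool.not_eq_true',
        ← Bool.not_eq_true, ← Bool.not_eq_true, ← Bool.not_eq_true,
        testBit_reachTable_iff_mem_openConn, testBit_reachTable_iff_mem_openConn,
        testBit_reachTable_iff_mem_openConn]
      simp only [Set.mem_inter_iff, Set.mem_compl_iff, and_assoc])).symm

/-- **From one rational comparison to `K·P(ab|c) < Δ`.**  For a weighted edge list `l` (distinct pairs, weights in `[0,1]`),
vertices `a b c` and a rational `K`: if `K·#(ab|c) < #(abc)·#(a|b|c) − #(ac|b)·#(a|bc)` for the exact weighted counts, then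
`K·P(ab|c) < P(abc)P(a|b|c) − P(ac|b)P(a|bc)` under `prodBernoulli (wOfList l)`. [this work] -/
theorem conj101_lt_of_wcheck {n : ℕ} (l : List (Fin n × Fin n × ℚ)) (hnd : (wPairs l).Nodup)
    (hq : ∀ e ∈ l, 0 ≤ e.2.2 ∧ e.2.2 ≤ 1) (a b c : Fin n) (K : ℚ)
    (h : K * ((wtabs n l).map fun t =>
            if (t.1.getD a 0).testBit b && !(t.1.getD a 0).testBit c then t.2 else 0).sum
        < ((wtabs n l).map fun t =>
            if (t.1.getD a 0).testBit b && (t.1.getD a 0).testBit c then t.2 else 0).sum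
          * ((wtabs n l).map fun t =>
            if !(t.1.getD a 0).testBit b && !(t.1.getD a 0).testBit c && !(t.1.getD b 0).testBit c
              then t.2 else 0).sum
        - ((wtabs n l).map fun t =>
            if (t.1.getD a 0).testBit c && !(t.1.getD a 0).testBit b then t.2 else 0).sum
          * ((wtabs n l).map fun t =>
            if (t.1.getD b 0).testBit c && !(t.1.getD a 0).testBit b then t.2 else 0).sum) :
    (K : ℝ) * (prodBernoulli (wOfList l)).real (openConn a b ∩ (openConn a c)ᶜ)
      < (prodBernoulli (wOfList l)).real (openConn a b ∩ openConn a c)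
          * (prodBernoulli (wOfList l)).real ((openConn a b)ᶜ ∩ (openConn a c)ᶜ ∩ (openConn b c)ᶜ)
        - (prodBernoulli (wOfList l)).real (openConn a c ∩ (openConn a b)ᶜ)
          * (prodBernoulli (wOfList l)).real (openConn b c ∩ (openConn a b)ᶜ) := by
  rw [IncStar.real_inter_openConn_eq_wcount hnd hq, real_sep3_eq_wcount hnd hq,
    real_conn_notConn_eq_wcount hnd hq, real_conn_notConn_eq_wcount hnd hq, real_conn_notConn_eq_wcount hnd hq]
  exact_mod_cast h

/-! ### The witnesses `CH_4` and `CH_5` -/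

/-- **`Δ > 4·P(ab|c)` on seven vertices.**  Chain-hub graph `CH_4` on `Fin 7` (`a = 0`, `c = 1`, `b = 2`, hubs `3,4,5,6`):
pairs `c–h_i` of weight `9/10`, `a–h₁ = (0,3)`, `h₄–b = (6,2)` and the chain `(3,4),(4,5),(5,6)` of weight `1/10`, `a–c = (0,1)` of
weight `99/100`.  Then `4·P(ab|c) < P(abc)P(a|b|c) − P(ac|b)P(a|bc)` (exactly: `P(ab|c) = 10⁻¹¹`, ratio `4.16529…`).
DECLARED `native_decide`. [this work] -/
theorem conj101_ratio_gt_four :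
    (4 : ℝ) * (prodBernoulli (wOfList ([(1, 3, 9/10), (1, 4, 9/10), (1, 5, 9/10), (1, 6, 9/10), (0, 3, 1/10), (6, 2, 1/10),
          (3, 4, 1/10), (4, 5, 1/10), (5, 6, 1/10), (0, 1, 99/100)] : List (Fin 7 × Fin 7 × ℚ)))).real
        (openConn (0 : Fin 7) 2 ∩ (openConn (0 : Fin 7) 1)ᶜ)
      < (prodBernoulli (wOfList ([(1, 3, 9/10), (1, 4, 9/10), (1, 5, 9/10), (1, 6, 9/10), (0, 3, 1/10), (6, 2, 1/10),
          (3, 4, 1/10), (4, 5, 1/10), (5, 6, 1/10), (0, 1, 99/100)] : List (Fin 7 × Fin 7 × ℚ)))).real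
            (openConn (0 : Fin 7) 2 ∩ openConn (0 : Fin 7) 1)
          * (prodBernoulli (wOfList ([(1, 3, 9/10), (1, 4, 9/10), (1, 5, 9/10), (1, 6, 9/10), (0, 3, 1/10), (6, 2, 1/10),
          (3, 4, 1/10), (4, 5, 1/10), (5, 6, 1/10), (0, 1, 99/100)] : List (Fin 7 × Fin 7 × ℚ)))).real
            ((openConn (0 : Fin 7) 2)ᶜ ∩ (openConn (0 : Fin 7) 1)ᶜ ∩ (openConn (2 : Fin 7) 1)ᶜ)
        - (prodBernoulli (wOfList ([(1, 3, 9/10), (1, 4, 9/10), (1, 5, 9/10), (1, 6, 9/10), (0, 3, 1/10), (6, 2, 1/10),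
          (3, 4, 1/10), (4, 5, 1/10), (5, 6, 1/10), (0, 1, 99/100)] : List (Fin 7 × Fin 7 × ℚ)))).real
            (openConn (0 : Fin 7) 1 ∩ (openConn (0 : Fin 7) 2)ᶜ)
          * (prodBernoulli (wOfList ([(1, 3, 9/10), (1, 4, 9/10), (1, 5, 9/10), (1, 6, 9/10), (0, 3, 1/10), (6, 2, 1/10),
          (3, 4, 1/10), (4, 5, 1/10), (5, 6, 1/10), (0, 1, 99/100)] : List (Fin 7 × Fin 7 × ℚ)))).real
            (openConn (2 : Fin 7) 1 ∩ (openConn (0 : Fin 7) 2)ᶜ) :=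
  conj101_lt_of_wcheck _ (by decide) (by native_decide) 0 2 1 4 (by native_decide)

/-- **`Δ > 5·P(ab|c)` on eight vertices.**  Chain-hub graph `CH_5` on `Fin 8` (`a = 0`, `c = 1`, `b = 2`, hubs `3,…,7`):
pairs `c–h_i` of weight `19/20`, `a–h₁ = (0,3)`, `h₅–b = (7,2)` and the chain `(3,4),…,(6,7)` of weight `1/20`, `a–c` of weight
`99/100`.  Then `5·P(ab|c) < P(abc)P(a|b|c) − P(ac|b)P(a|bc)` (ratio `5.46485…`, `P(ab|c) ≈ 4.88·10⁻¹⁷`).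
DECLARED `native_decide`. [this work] -/
theorem conj101_ratio_gt_five :
    (5 : ℝ) * (prodBernoulli (wOfList ([(1, 3, 19/20), (1, 4, 19/20), (1, 5, 19/20), (1, 6, 19/20), (1, 7, 19/20),
          (0, 3, 1/20), (7, 2, 1/20), (3, 4, 1/20), (4, 5, 1/20), (5, 6, 1/20), (6, 7, 1/20), (0, 1, 99/100)] :
          List (Fin 8 × Fin 8 × ℚ)))).real
        (openConn (0 : Fin 8) 2 ∩ (openConn (0 : Fin 8) 1)ᶜ)
      < (prodBernoulli (wOfList ([(1, 3, 19/20), (1, 4, 19/20), (1, 5, 19/20), (1, 6, 19/20), (1, 7, 19/20),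
          (0, 3, 1/20), (7, 2, 1/20), (3, 4, 1/20), (4, 5, 1/20), (5, 6, 1/20), (6, 7, 1/20), (0, 1, 99/100)] :
          List (Fin 8 × Fin 8 × ℚ)))).real
            (openConn (0 : Fin 8) 2 ∩ openConn (0 : Fin 8) 1)
          * (prodBernoulli (wOfList ([(1, 3, 19/20), (1, 4, 19/20), (1, 5, 19/20), (1, 6, 19/20), (1, 7, 19/20),
          (0, 3, 1/20), (7, 2, 1/20), (3, 4, 1/20), (4, 5, 1/20), (5, 6, 1/20), (6, 7, 1/20), (0, 1, 99/100)] :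
          List (Fin 8 × Fin 8 × ℚ)))).real
            ((openConn (0 : Fin 8) 2)ᶜ ∩ (openConn (0 : Fin 8) 1)ᶜ ∩ (openConn (2 : Fin 8) 1)ᶜ)
        - (prodBernoulli (wOfList ([(1, 3, 19/20), (1, 4, 19/20), (1, 5, 19/20), (1, 6, 19/20), (1, 7, 19/20),
          (0, 3, 1/20), (7, 2, 1/20), (3, 4, 1/20), (4, 5, 1/20), (5, 6, 1/20), (6, 7, 1/20), (0, 1, 99/100)] :
          List (Fin 8 × Fin 8 × ℚ)))).real
            (openConn (0 : Fin 8) 1 ∩ (openConn (0 : Fin 8) 2)ᶜ)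
          * (prodBernoulli (wOfList ([(1, 3, 19/20), (1, 4, 19/20), (1, 5, 19/20), (1, 6, 19/20), (1, 7, 19/20),
          (0, 3, 1/20), (7, 2, 1/20), (3, 4, 1/20), (4, 5, 1/20), (5, 6, 1/20), (6, 7, 1/20), (0, 1, 99/100)] :
          List (Fin 8 × Fin 8 × ℚ)))).real
            (openConn (2 : Fin 8) 1 ∩ (openConn (0 : Fin 8) 2)ᶜ) :=
  conj101_lt_of_wcheck _ (by decide) (by native_decide) 0 2 1 5 (by native_decide)

/-! ### No linear rate with constant `≤ 5` -/

/-- **The linear form of Gladkov's Conjecture 10.1 fails with constant `4`.**  It is NOT true that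
`P(abc)·P(a|b|c) − P(ac|b)·P(a|bc) ≤ 4·P(ab|c)` for every finite weighted graph and all distinct `a, b, c`
(cells via `openConn` as in `Literature.Probability.Percolation.gladkov2024_thm_1_3`). [this work] -/
theorem not_conj101_rate_four :
    ¬ ∀ (n : ℕ) (w : Sym2 (Fin n) → unitInterval) (a b c : Fin n), a ≠ b → a ≠ c → b ≠ c →
      (prodBernoulli w).real (openConn a b ∩ openConn a c)
          * (prodBernoulli w).real ((openConn a b)ᶜ ∩ (openConn a c)ᶜ ∩ (openConn b c)ᶜ)
        - (prodBernoulli w).real (openConn a c ∩ (openConn a b)ᶜ)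
          * (prodBernoulli w).real (openConn b c ∩ (openConn a b)ᶜ)
      ≤ 4 * (prodBernoulli w).real (openConn a b ∩ (openConn a c)ᶜ) := by
  intro h
  have h0 := h 7 (wOfList ([(1, 3, 9/10), (1, 4, 9/10), (1, 5, 9/10), (1, 6, 9/10), (0, 3, 1/10), (6, 2, 1/10),
          (3, 4, 1/10), (4, 5, 1/10), (5, 6, 1/10), (0, 1, 99/100)] : List (Fin 7 × Fin 7 × ℚ))) 0 2 1
    (by decide) (by decide) (by decide)
  have h1 := conj101_ratio_gt_four
  linarith

/-- **The linear form of Gladkov's Conjecture 10.1 fails with constant `5`.**  Same statement with `5` in place of `4`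
(witness `CH_5` on `Fin 8`). [this work] -/
theorem not_conj101_rate_five :
    ¬ ∀ (n : ℕ) (w : Sym2 (Fin n) → unitInterval) (a b c : Fin n), a ≠ b → a ≠ c → b ≠ c →
      (prodBernoulli w).real (openConn a b ∩ openConn a c)
          * (prodBernoulli w).real ((openConn a b)ᶜ ∩ (openConn a c)ᶜ ∩ (openConn b c)ᶜ)
        - (prodBernoulli w).real (openConn a c ∩ (openConn a b)ᶜ)
          * (prodBernoulli w).real (openConn b c ∩ (openConn a b)ᶜ)
      ≤ 5 * (prodBernoulli w).real (openConn a b ∩ (openConn a c)ᶜ) := by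
  intro h
  have h0 := h 8 (wOfList ([(1, 3, 19/20), (1, 4, 19/20), (1, 5, 19/20), (1, 6, 19/20), (1, 7, 19/20),
          (0, 3, 1/20), (7, 2, 1/20), (3, 4, 1/20), (4, 5, 1/20), (5, 6, 1/20), (6, 7, 1/20), (0, 1, 99/100)] :
          List (Fin 8 × Fin 8 × ℚ))) 0 2 1
    (by decide) (by decide) (by decide)
  have h1 := conj101_ratio_gt_five
  linarith

/-- **No `ε`–`δ` rate `δ = ε/5` in Conjecture 10.1.**  It is NOT true that for every `ε > 0`, every finite weighted graph and
distinct `a, b, c` with `P(ab|c) < ε/5` satisfy `P(abc)P(a|b|c) − P(ac|b)P(a|bc) < ε`: the witness `CH_5` with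
`ε := (P(abc)P(a|b|c) − P(ac|b)P(a|bc))` (which is `> 5·P(ab|c) ≥ 0` there). [this work] -/
theorem not_conj101_delta_eq_eps_div_five :
    ¬ ∀ (ε : ℝ), 0 < ε → ∀ (n : ℕ) (w : Sym2 (Fin n) → unitInterval) (a b c : Fin n), a ≠ b → a ≠ c → b ≠ c →
      (prodBernoulli w).real (openConn a b ∩ (openConn a c)ᶜ) < ε / 5 →
      (prodBernoulli w).real (openConn a b ∩ openConn a c)
          * (prodBernoulli w).real ((openConn a b)ᶜ ∩ (openConn a c)ᶜ ∩ (openConn b c)ᶜ)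
        - (prodBernoulli w).real (openConn a c ∩ (openConn a b)ᶜ)
          * (prodBernoulli w).real (openConn b c ∩ (openConn a b)ᶜ) < ε := by
  intro h
  apply not_conj101_rate_five
  intro n w a b c hab hac hbc
  by_contra hlt
  rw [not_le] at hlt
  have hp : 0 ≤ (prodBernoulli w).real (openConn a b ∩ (openConn a c)ᶜ) := measureReal_nonneg
  have h0 := h ((prodBernoulli w).real (openConn a b ∩ openConn a c)
          * (prodBernoulli w).real ((openConn a b)ᶜ ∩ (openConn a c)ᶜ ∩ (openConn b c)ᶜ)
        - (prodBernoulli w).real (openConn a c ∩ (openConn a b)ᶜ)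
          * (prodBernoulli w).real (openConn b c ∩ (openConn a b)ᶜ)) (by linarith) n w a b c hab hac hbc
    (by linarith)
  linarith

end GladkovRate

end Summit.CriticalPhenomena.PercolationContinuityZ3.Theorems
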